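/- EXTRA WIDTH seat `ym-line-cbag-p1-w5` (g11), LINE 7 `GlueballBandRecursion`, in support of ⟨stmt-QuantumFields-22957⟩
`OneParticleBlochSymbolFamily` (= `Band.EffectiveBlochSymbolFamily`): the calculus of the planner's stub S3
`stub_symbolRegularityUniform` (STUB-PLAN 2026-08-28T18:17Z) — regularity of a matrix symbol that is a finite trigonometric sum
(the symbol of a finite-range / truncated hopping kernel on the torus).  Route-independent (no `Theses` import); definition-free. -/
import Summits.QuantumFields.YangMills.Theorems.GlueballBandRecursionBlochReduction

/-!
# Route `GlueballBandRecursion`: regularity of trigonometric matrix symbols (stub S3 prefab)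

The effective one-particle Bloch symbol family (`Band.EffectiveBlochSymbolFamily`, item ⟨stmt-QuantumFields-22957⟩) asks, per
torus size `N`, for a `2π`-periodic Hermitian matrix symbol `B̃ : ℝ³ → Mat_n(ℂ)` whose Rayleigh quotients
`R_u(q) = Re⟪u, B̃(q) u⟫` (`‖u‖ = 1`) are (P1) positive and (P2) log-C²:
`2 log R_u(x) − K|v|² ≤ log R_u(x+v) + log R_u(x−v)` for all `x, v`, with `K` uniform in `N` (and `β`), and (P3) whose supremum
`Λ` is attained.  A cluster expansion delivers such a symbol as a FINITE TRIGONOMETRIC SUM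
`B̃(q) = Σ_y e^{−i q·w_y} J_y` (`w_y ∈ ℤ³` the hopping vectors, `J_y ∈ Mat_n(ℂ)` the hopping matrices, the on-site term `w = 0`
dominating).  This file proves, DEFINITION-FREE (the symbol `Bt` is bound to its defining sum by a hypothesis `hBt`), in the LITERAL
field shape of `Band.EffectiveBlochSymbolFamily`:

* §1 the one-variable engine: if `r > r₀ > 0`, `(r')² ≤ A`, `r'' ≥ −B` on `ℝ` then `2 log r(0) − (B/r₀ + A/r₀²) ≤ log r(1) + log r(−1)`
  (convexity of `log r + K s²/2`);
* §2 finite trigonometric sums along a line `s ↦ Σ_y c_y e^{−i(θ_y + s ω_y)}`: derivatives and their bounds `Σ‖c_y‖|ω_y|`,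
  `Σ‖c_y‖ω_y²`, and the log second-difference bound; §3 the same on `ℝ³` (`θ_y = x·w_y`, `ω_y = v·w_y`, Cauchy–Schwarz
  `ω_y² ≤ |v|²|w_y|²`) and `2π`-periodicity of the phases;
* §4 the matrix symbol: Rayleigh-quotient reduction to §3 (`c_y = ⟪u, J_y u⟫`), periodicity `B̃(q + 2πz) = B̃(q)`, Hermiticity from
  kernel symmetry (`w_{σy} = −w_y`, `J_{σy} = J_yᴴ`), (P1) positivity `R_u ≥ r₀` from diagonal dominance
  (`Re⟪u, J_{y₀} u⟫ ≥ r₀ + Σ_{y ≠ y₀} a_y`, `w_{y₀} = 0`), and (P2) the log-C² bound with the EXPLICIT constant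
  `K = M₂/r₀ + M₀M₂/r₀²`, `M₀ = Σ_y a_y`, `M₂ = Σ_y a_y |w_y|²` for any majorant `‖⟪u, J_y u⟫‖ ≤ a_y` — so `K` is uniform in
  whatever the kernel bounds are uniform in (`N`, `β`); plus the entrywise majorant `‖⟪u, A u⟫‖ ≤ Σ_{jk} ‖A_{jk}‖`.

Sources: folklore calculus (second-difference / convexity) and finite Fourier sums.  Deliberately NOT here: the transfer matrix, the
cluster expansion (stubs S1/S4), the existence of the kernel; the attained supremum, volume comparison and the lattice-angle bridge
to `…BlochReduction` are in the companion file `…SymbolSupremum`.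

HONEST FRAMING.  Calculus and finite-dimensional linear algebra only.  Neither item 22957, nor the rung
`ColdDoublingRecursionStrongCoupling`, nor the Yang–Mills mass gap is proved or advanced here.
-/

set_option autoImplicit false

noncomputable section

open Finset Complex
open scoped InnerProductSpace Real ComplexConjugate Matrix

namespace Summit.QuantumFields.YangMills.Theorems.GlueballBandRecursion.Symbol

/-! ## §1 One-variable engine: a symmetric second difference of `log r` -/

/-- **Second-difference bound for `log r`.**  If `r` is twice differentiable on `ℝ` with `r ≥ r₀ > 0`, `(r')² ≤ A` and `r'' ≥ −B`
(`B ≥ 0`), then `2 log r(0) − (B/r₀ + A/r₀²) ≤ log r(1) + log r(−1)`.  (Proof: `(log r)'' = r''/r − (r'/r)² ≥ −K`, so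
`log r + K s²/2` is convex.) [folklore] -/
theorem two_mul_log_le_of_deriv2 {r r' r'' : ℝ → ℝ} (hr : ∀ s, HasDerivAt r (r' s) s) (hr' : ∀ s, HasDerivAt r' (r'' s) s)
    {r₀ A B : ℝ} (hr₀ : 0 < r₀) (hB₀ : 0 ≤ B) (hpos : ∀ s, r₀ ≤ r s) (hA : ∀ s, r' s ^ 2 ≤ A) (hB : ∀ s, -B ≤ r'' s) :
    2 * Real.log (r 0) - (B / r₀ + A / r₀ ^ 2) ≤ Real.log (r 1) + Real.log (r (-1)) := by
  have hrpos : ∀ s, 0 < r s := fun s => hr₀.trans_le (hpos s)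
  have hrne : ∀ s, r s ≠ 0 := fun s => (hrpos s).ne'
  have hA0 : 0 ≤ A := (sq_nonneg _).trans (hA 0)
  obtain ⟨K, hK⟩ : ∃ K : ℝ, K = B / r₀ + A / r₀ ^ 2 := ⟨_, rfl⟩
  -- `log ∘ r` and its two derivatives
  have hd1 : ∀ s, HasDerivAt (fun s => Real.log (r s)) (r' s / r s) s := fun s => (hr s).log (hrne s)
  have hd2 : ∀ s, HasDerivAt (fun s => r' s / r s) ((r'' s * r s - r' s * r' s) / r s ^ 2) s :=
    fun s => (hr' s).div (hr s) (hrne s)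
  -- the lower bound `(log r)'' ≥ -K`
  have hlow : ∀ s, -K ≤ (r'' s * r s - r' s * r' s) / r s ^ 2 := by
    intro s
    have hrs := hrpos s
    rw [hK, le_div_iff₀ (pow_pos hrs 2)]
    have h1 : r' s * r' s ≤ A := by rw [← sq]; exact hA s
    have h2 : -B * r s ≤ r'' s * r s := mul_le_mul_of_nonneg_right (hB s) hrs.le
    have h3 : B * r s ≤ B / r₀ * r s ^ 2 := by
      have h4 : B ≤ B / r₀ * r s := by
        rw [div_mul_eq_mul_div, le_div_iff₀ hr₀]
        exact mul_le_mul_of_nonneg_left (hpos s) hB₀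
      nlinarith
    have h5 : A ≤ A / r₀ ^ 2 * r s ^ 2 := by
      rw [div_mul_eq_mul_div, le_div_iff₀ (pow_pos hr₀ 2)]
      exact mul_le_mul_of_nonneg_left (pow_le_pow_left₀ hr₀.le (hpos s) 2) hA0
    nlinarith
  -- `φ(s) = log r(s) + K s²/2` is convex
  have hφ1 : ∀ s, HasDerivAt (fun s => Real.log (r s) + K / 2 * s ^ 2) (r' s / r s + K * s) s := by
    intro s
    have h2 : HasDerivAt (fun x : ℝ => K / 2 * x ^ 2) (K / 2 * ((2 : ℕ) * s ^ (2 - 1))) s :=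
      (hasDerivAt_pow 2 s).const_mul (K / 2)
    have h3 : K / 2 * ((2 : ℕ) * s ^ (2 - 1) : ℝ) = K * s := by
      rw [show ((2 : ℕ) : ℝ) = 2 by norm_num, show (2 - 1 : ℕ) = 1 by norm_num, pow_one]
      ring
    exact (hd1 s).fun_add (h2.congr_deriv h3)
  have hφ2 : ∀ s, HasDerivAt (fun s => r' s / r s + K * s) ((r'' s * r s - r' s * r' s) / r s ^ 2 + K) s := by
    intro s
    have h2 : HasDerivAt (fun x : ℝ => K * x) K s := by
      simpa using (hasDerivAt_id s).const_mul K
    exact (hd2 s).fun_add h2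
  have hdiff : Differentiable ℝ (fun s => Real.log (r s) + K / 2 * s ^ 2) := fun s => (hφ1 s).differentiableAt
  have hderiv : deriv (fun s => Real.log (r s) + K / 2 * s ^ 2) = fun s => r' s / r s + K * s :=
    funext fun s => (hφ1 s).deriv
  have hdiff2 : Differentiable ℝ (deriv (fun s => Real.log (r s) + K / 2 * s ^ 2)) := by
    rw [hderiv]
    exact fun s => (hφ2 s).differentiableAt
  have hconv : ConvexOn ℝ Set.univ (fun s => Real.log (r s) + K / 2 * s ^ 2) := by
    refine convexOn_univ_of_deriv2_nonneg hdiff hdiff2 fun s => ?_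
    show 0 ≤ deriv (deriv (fun s => Real.log (r s) + K / 2 * s ^ 2)) s
    rw [hderiv, (hφ2 s).deriv]
    linarith [hlow s]
  have hmid := hconv.2 (Set.mem_univ (1 : ℝ)) (Set.mem_univ (-1 : ℝ)) (by norm_num : (0 : ℝ) ≤ 1 / 2)
    (by norm_num : (0 : ℝ) ≤ 1 / 2) (by norm_num)
  simp only [smul_eq_mul] at hmid
  norm_num at hmid
  linarith

/-! ## §2 Finite trigonometric sums along a line -/

variable {ι : Type*} [Fintype ι]

/-- The phase `s ↦ e^{−i(θ + sω)}` has derivative `e^{−i(θ + sω)}·(−iω)`. [folklore] -/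
theorem hasDerivAt_phase (θ ω s : ℝ) :
    HasDerivAt (fun s : ℝ => cexp (((-(θ + s * ω) : ℝ) : ℂ) * I))
      (cexp (((-(θ + s * ω) : ℝ) : ℂ) * I) * (((-ω : ℝ) : ℂ) * I)) s := by
  have h1 : HasDerivAt (fun s : ℝ => -(θ + s * ω)) (-ω) s := by
    simpa using (((hasDerivAt_id s).mul_const ω).const_add θ).fun_neg
  exact (h1.ofReal_comp.mul_const I).cexp

/-- Derivative of the line sum `s ↦ Σ_y c_y e^{−i(θ_y + sω_y)}`. [folklore] -/
theorem hasDerivAt_lineSum (c : ι → ℂ) (θ ω : ι → ℝ) (s : ℝ) :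
    HasDerivAt (fun s : ℝ => ∑ y, c y * cexp (((-(θ y + s * ω y) : ℝ) : ℂ) * I))
      (∑ y, c y * (cexp (((-(θ y + s * ω y) : ℝ) : ℂ) * I) * (((-ω y : ℝ) : ℂ) * I))) s :=
  HasDerivAt.fun_sum fun y _ => (hasDerivAt_phase (θ y) (ω y) s).const_mul (c y)

/-- Derivative of the derivative of the line sum. [folklore] -/
theorem hasDerivAt_lineSum_deriv (c : ι → ℂ) (θ ω : ι → ℝ) (s : ℝ) :
    HasDerivAt (fun s : ℝ => ∑ y, c y * (cexp (((-(θ y + s * ω y) : ℝ) : ℂ) * I) * (((-ω y : ℝ) : ℂ) * I)))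
      (∑ y, c y * (cexp (((-(θ y + s * ω y) : ℝ) : ℂ) * I) * (((-ω y : ℝ) : ℂ) * I) * (((-ω y : ℝ) : ℂ) * I))) s :=
  HasDerivAt.fun_sum fun y _ => ((hasDerivAt_phase (θ y) (ω y) s).mul_const _).const_mul (c y)

/-- Real part of a derivative. [folklore] -/
theorem hasDerivAt_re_comp {e : ℝ → ℂ} {e' : ℂ} {s : ℝ} (h : HasDerivAt e e' s) :
    HasDerivAt (fun s => (e s).re) e'.re s := by
  have h2 := Complex.reCLM.hasFDerivAt.comp_hasDerivAt s h
  simpa [Function.comp_def] using h2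

/-- `‖Σ_y c_y e^{−i(θ_y+sω_y)}(−iω_y)‖ ≤ Σ_y ‖c_y‖ |ω_y|`. [folklore] -/
theorem norm_lineSum_deriv_le (c : ι → ℂ) (θ ω : ι → ℝ) (s : ℝ) :
    ‖∑ y, c y * (cexp (((-(θ y + s * ω y) : ℝ) : ℂ) * I) * (((-ω y : ℝ) : ℂ) * I))‖ ≤ ∑ y, ‖c y‖ * |ω y| := by
  refine (norm_sum_le _ _).trans (le_of_eq (Finset.sum_congr rfl fun y _ => ?_))
  rw [norm_mul, norm_mul, norm_mul, Complex.norm_exp_ofReal_mul_I, Complex.norm_I, Complex.norm_real, Real.norm_eq_abs,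
    abs_neg]
  ring

/-- `‖Σ_y c_y e^{−i(θ_y+sω_y)}(−iω_y)²‖ ≤ Σ_y ‖c_y‖ ω_y²`. [folklore] -/
theorem norm_lineSum_deriv2_le (c : ι → ℂ) (θ ω : ι → ℝ) (s : ℝ) :
    ‖∑ y, c y * (cexp (((-(θ y + s * ω y) : ℝ) : ℂ) * I) * (((-ω y : ℝ) : ℂ) * I) * (((-ω y : ℝ) : ℂ) * I))‖ ≤
      ∑ y, ‖c y‖ * ω y ^ 2 := by
  refine (norm_sum_le _ _).trans (le_of_eq (Finset.sum_congr rfl fun y _ => ?_))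
  rw [norm_mul, norm_mul, norm_mul, norm_mul, Complex.norm_exp_ofReal_mul_I, Complex.norm_I, Complex.norm_real,
    Real.norm_eq_abs, abs_neg, ← sq_abs (ω y)]
  ring

/-- **Log second difference of a positive trigonometric sum along a line.**  Let `r(s) = Re Σ_y c_y e^{−i(θ_y + sω_y)}` with
`‖c_y‖ ≤ a_y`, `r ≥ r₀ > 0` everywhere, and `Σ_y a_y ω_y² ≤ B`.  Then
`2 log r(0) − (B/r₀ + (Σ_y a_y)·B/r₀²) ≤ log r(1) + log r(−1)`. [folklore] -/
theorem line_two_mul_log_le (c : ι → ℂ) (θ ω : ι → ℝ) {a : ι → ℝ} (ha : ∀ y, ‖c y‖ ≤ a y) (r : ℝ → ℝ)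
    (hr : ∀ s, r s = (∑ y, c y * cexp (((-(θ y + s * ω y) : ℝ) : ℂ) * I)).re) {r₀ : ℝ} (hr₀ : 0 < r₀)
    (hpos : ∀ s, r₀ ≤ r s) {B : ℝ} (hB : ∑ y, a y * ω y ^ 2 ≤ B) :
    2 * Real.log (r 0) - (B / r₀ + (∑ y, a y) * B / r₀ ^ 2) ≤ Real.log (r 1) + Real.log (r (-1)) := by
  -- the complex line sum and its derivatives
  set e' : ℝ → ℂ := fun s => ∑ y, c y * (cexp (((-(θ y + s * ω y) : ℝ) : ℂ) * I) * (((-ω y : ℝ) : ℂ) * I)) with he'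
  set e'' : ℝ → ℂ := fun s =>
    ∑ y, c y * (cexp (((-(θ y + s * ω y) : ℝ) : ℂ) * I) * (((-ω y : ℝ) : ℂ) * I) * (((-ω y : ℝ) : ℂ) * I)) with he''
  have hr_eq : r = fun s => (∑ y, c y * cexp (((-(θ y + s * ω y) : ℝ) : ℂ) * I)).re := funext hr
  have hd1 : ∀ s, HasDerivAt r (e' s).re s := fun s => by
    rw [hr_eq]
    exact hasDerivAt_re_comp (hasDerivAt_lineSum c θ ω s)
  have hd2 : ∀ s, HasDerivAt (fun s => (e' s).re) (e'' s).re s := fun s =>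
    hasDerivAt_re_comp (hasDerivAt_lineSum_deriv c θ ω s)
  have ha0 : ∀ y, 0 ≤ a y := fun y => (norm_nonneg _).trans (ha y)
  have hM0 : ∑ y, ‖c y‖ ≤ ∑ y, a y := Finset.sum_le_sum fun y _ => ha y
  have hM2 : ∑ y, ‖c y‖ * ω y ^ 2 ≤ B :=
    (Finset.sum_le_sum fun y _ => mul_le_mul_of_nonneg_right (ha y) (sq_nonneg _)).trans hB
  have hB0 : 0 ≤ B := (Finset.sum_nonneg fun y _ => mul_nonneg (ha0 y) (sq_nonneg _)).trans hB
  -- first-derivative bound `(r')² ≤ (Σ a)·B` by Cauchy–Schwarz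
  have hA : ∀ s, (e' s).re ^ 2 ≤ (∑ y, a y) * B := by
    intro s
    have h1 : |(e' s).re| ≤ ∑ y, ‖c y‖ * |ω y| := (Complex.abs_re_le_norm _).trans (norm_lineSum_deriv_le c θ ω s)
    have h2 : (∑ y, ‖c y‖ * |ω y|) ^ 2 ≤ (∑ y, ‖c y‖) * ∑ y, ‖c y‖ * ω y ^ 2 :=
      Finset.sum_sq_le_sum_mul_sum_of_sq_le_mul _ (fun y _ => norm_nonneg _)
        (fun y _ => mul_nonneg (norm_nonneg _) (sq_nonneg _)) (fun y _ => by rw [mul_pow, sq_abs]; exact le_of_eq (by ring))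
    have h3 : (e' s).re ^ 2 ≤ (∑ y, ‖c y‖ * |ω y|) ^ 2 := by
      rw [← sq_abs ((e' s).re)]
      exact pow_le_pow_left₀ (abs_nonneg _) h1 2
    calc (e' s).re ^ 2 ≤ (∑ y, ‖c y‖) * ∑ y, ‖c y‖ * ω y ^ 2 := h3.trans h2
      _ ≤ (∑ y, a y) * B := mul_le_mul hM0 hM2 (Finset.sum_nonneg fun y _ => mul_nonneg (norm_nonneg _) (sq_nonneg _))
          (Finset.sum_nonneg fun y _ => ha0 y)
  -- second-derivative bound `r'' ≥ -B`
  have hB' : ∀ s, -B ≤ (e'' s).re := by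
    intro s
    have h1 : |(e'' s).re| ≤ B :=
      ((Complex.abs_re_le_norm _).trans (norm_lineSum_deriv2_le c θ ω s)).trans hM2
    exact (abs_le.1 h1).1
  exact two_mul_log_le_of_deriv2 hd1 hd2 hr₀ hB0 hpos hA hB'

/-! ## §3 Trigonometric sums on `ℝ³`: lines and periodicity -/

/-- `(x + s v)·w = x·w + s (v·w)`. [folklore] -/
theorem dot_add_smul (x v : Fin 3 → ℝ) (w : Fin 3 → ℤ) (s : ℝ) :
    ∑ i, (x + s • v) i * (w i : ℝ) = (∑ i, x i * (w i : ℝ)) + s * ∑ i, v i * (w i : ℝ) := by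
  simp only [Pi.add_apply, Pi.smul_apply, smul_eq_mul, add_mul, Finset.sum_add_distrib, Finset.mul_sum, mul_assoc]

/-- Cauchy–Schwarz: `(v·w)² ≤ |v|²|w|²`. [folklore] -/
theorem dot_sq_le (v : Fin 3 → ℝ) (w : Fin 3 → ℤ) :
    (∑ i, v i * (w i : ℝ)) ^ 2 ≤ (∑ i, v i ^ 2) * ∑ i, (w i : ℝ) ^ 2 :=
  Finset.sum_mul_sq_le_sq_mul_sq _ _ _

/-- **`2π`-periodicity of the phases**: `e^{−i(q + 2πz)·w} = e^{−i q·w}` for `w, z ∈ ℤ³`. [folklore] -/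
theorem phase_periodic (w : Fin 3 → ℤ) (q : Fin 3 → ℝ) (z : Fin 3 → ℤ) :
    cexp (((-(∑ i, (q i + 2 * π * z i) * (w i : ℝ)) : ℝ) : ℂ) * I) =
      cexp (((-(∑ i, q i * (w i : ℝ)) : ℝ) : ℂ) * I) := by
  have hsum : ∑ i, (q i + 2 * π * z i) * (w i : ℝ) = ∑ i, q i * (w i : ℝ) + 2 * π * ((∑ i, z i * w i : ℤ) : ℝ) := by
    push_cast
    rw [Finset.mul_sum, ← Finset.sum_add_distrib]
    exact Finset.sum_congr rfl fun i _ => by ring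
  rw [hsum, neg_add, Complex.ofReal_add, add_mul, Complex.exp_add]
  have h1 : cexp (((-(2 * π * ((∑ i, z i * w i : ℤ) : ℝ)) : ℝ) : ℂ) * I) = 1 := by
    have := Complex.exp_int_mul_two_pi_mul_I (-(∑ i, z i * w i))
    rw [← this]
    congr 1
    push_cast
    ring
  rw [h1, mul_one]

/-- **Log second difference of a positive trigonometric sum on `ℝ³`.**  Let `g(q) = Re Σ_y c_y e^{−i q·w_y}` (`w_y ∈ ℤ³`) with
`‖c_y‖ ≤ a_y` and `g ≥ r₀ > 0` everywhere.  Then for all `x, v`: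
`2 log g(x) − (M₂/r₀ + M₀M₂/r₀²)|v|² ≤ log g(x+v) + log g(x−v)`, `M₀ = Σ_y a_y`, `M₂ = Σ_y a_y |w_y|²`. [folklore] -/
theorem trigSum_two_mul_log_le (c : ι → ℂ) (w : ι → Fin 3 → ℤ) {a : ι → ℝ} (ha : ∀ y, ‖c y‖ ≤ a y)
    (g : (Fin 3 → ℝ) → ℝ) (hg : ∀ q, g q = (∑ y, c y * cexp (((-(∑ i, q i * (w y i : ℝ)) : ℝ) : ℂ) * I)).re)
    {r₀ : ℝ} (hr₀ : 0 < r₀) (hpos : ∀ q, r₀ ≤ g q) (x v : Fin 3 → ℝ) :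
    2 * Real.log (g x) -
        ((∑ y, a y * ∑ i, (w y i : ℝ) ^ 2) / r₀ + (∑ y, a y) * (∑ y, a y * ∑ i, (w y i : ℝ) ^ 2) / r₀ ^ 2) *
          ∑ i, v i ^ 2 ≤
      Real.log (g (x + v)) + Real.log (g (x - v)) := by
  obtain ⟨θ, hθ⟩ : ∃ θ : ι → ℝ, ∀ y, θ y = ∑ i, x i * (w y i : ℝ) := ⟨_, fun _ => rfl⟩
  obtain ⟨ω, hω⟩ : ∃ ω : ι → ℝ, ∀ y, ω y = ∑ i, v i * (w y i : ℝ) := ⟨_, fun _ => rfl⟩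
  obtain ⟨r, hr⟩ : ∃ r : ℝ → ℝ, ∀ s, r s = g (x + s • v) := ⟨_, fun _ => rfl⟩
  have hr' : ∀ s, r s = (∑ y, c y * cexp (((-(θ y + s * ω y) : ℝ) : ℂ) * I)).re := by
    intro s
    rw [hr, hg]
    simp only [dot_add_smul, hθ, hω]
  have ha0 : ∀ y, 0 ≤ a y := fun y => (norm_nonneg _).trans (ha y)
  have hB : ∑ y, a y * ω y ^ 2 ≤ (∑ i, v i ^ 2) * ∑ y, a y * ∑ i, (w y i : ℝ) ^ 2 := by
    rw [Finset.mul_sum]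
    refine Finset.sum_le_sum fun y _ => ?_
    have h1 : ω y ^ 2 ≤ (∑ i, v i ^ 2) * ∑ i, (w y i : ℝ) ^ 2 := by rw [hω]; exact dot_sq_le v (w y)
    calc a y * ω y ^ 2 ≤ a y * ((∑ i, v i ^ 2) * ∑ i, (w y i : ℝ) ^ 2) := mul_le_mul_of_nonneg_left h1 (ha0 y)
      _ = (∑ i, v i ^ 2) * (a y * ∑ i, (w y i : ℝ) ^ 2) := by ring
  have h := line_two_mul_log_le c θ ω ha r hr' hr₀ (fun s => by rw [hr]; exact hpos _) hB
  have h0 : r 0 = g x := by rw [hr, zero_smul, add_zero]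
  have h1 : r 1 = g (x + v) := by rw [hr, one_smul]
  have h2 : r (-1) = g (x - v) := by rw [hr, neg_one_smul, ← sub_eq_add_neg]
  rw [h0, h1, h2] at h
  have hK : (∑ i, v i ^ 2) * (∑ y, a y * ∑ i, (w y i : ℝ) ^ 2) / r₀ +
      (∑ y, a y) * ((∑ i, v i ^ 2) * ∑ y, a y * ∑ i, (w y i : ℝ) ^ 2) / r₀ ^ 2 =
      ((∑ y, a y * ∑ i, (w y i : ℝ) ^ 2) / r₀ + (∑ y, a y) * (∑ y, a y * ∑ i, (w y i : ℝ) ^ 2) / r₀ ^ 2) *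
        ∑ i, v i ^ 2 := by ring
  linarith

/-! ## §4 The matrix symbol `B̃(q) = Σ_y e^{−i q·w_y} J_y` -/

section MatrixSymbol

variable {n : ℕ} (w : ι → Fin 3 → ℤ) (J : ι → Matrix (Fin n) (Fin n) ℂ) (Bt : (Fin 3 → ℝ) → Matrix (Fin n) (Fin n) ℂ)
  (hBt : ∀ q, Bt q = ∑ y, cexp (((-(∑ i, q i * (w y i : ℝ)) : ℝ) : ℂ) * I) • J y)
include hBt

/-- **Rayleigh-quotient reduction**: `Re⟪u, B̃(q) u⟫ = Re Σ_y ⟪u, J_y u⟫ e^{−i q·w_y}` — a scalar trigonometric sum with coefficients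
`c_y = ⟪u, J_y u⟫`. [folklore] -/
theorem re_inner_symbol (u : EuclideanSpace ℂ (Fin n)) (q : Fin 3 → ℝ) :
    RCLike.re ⟪u, Matrix.toEuclideanLin (Bt q) u⟫_ℂ =
      (∑ y, ⟪u, Matrix.toEuclideanLin (J y) u⟫_ℂ * cexp (((-(∑ i, q i * (w y i : ℝ)) : ℝ) : ℂ) * I)).re := by
  rw [hBt, map_sum, LinearMap.sum_apply, inner_sum]
  simp only [map_smul, LinearMap.smul_apply, inner_smul_right, RCLike.re_to_complex, Complex.re_sum]
  exact Finset.sum_congr rfl fun y _ => by rw [mul_comm]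

/-- **Periodicity** `B̃(q + 2πz) = B̃(q)` (`z ∈ ℤ³`) — the first field of `EffectiveBlochSymbolFamily`. [folklore] -/
theorem symbol_periodic (q : Fin 3 → ℝ) (z : Fin 3 → ℤ) : Bt (fun i => q i + 2 * π * z i) = Bt q := by
  rw [hBt, hBt]
  exact Finset.sum_congr rfl fun y _ => by rw [phase_periodic]

/-- **Hermiticity from kernel symmetry**: if an index symmetry `σ` reverses the hopping vectors, `w_{σy} = −w_y`, and conjugates the
hopping matrices, `J_{σy} = J_yᴴ`, then `B̃(q)` is Hermitian for every `q`. [folklore] -/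
theorem symbol_isHermitian (σ : ι ≃ ι) (hw : ∀ y, w (σ y) = -w y) (hJ : ∀ y, J (σ y) = (J y)ᴴ) (q : Fin 3 → ℝ) :
    (Bt q).IsHermitian := by
  have hphase : ∀ y, star (cexp (((-(∑ i, q i * (w y i : ℝ)) : ℝ) : ℂ) * I)) =
      cexp (((-(∑ i, q i * (w (σ y) i : ℝ)) : ℝ) : ℂ) * I) := by
    intro y
    change conj (cexp _) = _
    rw [← Complex.exp_conj, map_mul, Complex.conj_ofReal, Complex.conj_I]
    congr 1
    have hS : ∑ i, q i * ((w (σ y) i : ℤ) : ℝ) = -∑ i, q i * ((w y i : ℤ) : ℝ) := by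
      rw [hw, ← Finset.sum_neg_distrib]
      exact Finset.sum_congr rfl fun i _ => by simp
    rw [hS, neg_neg]
    push_cast
    ring
  show (Bt q)ᴴ = Bt q
  rw [hBt, Matrix.conjTranspose_sum]
  simp only [Matrix.conjTranspose_smul]
  calc ∑ y, star (cexp (((-(∑ i, q i * (w y i : ℝ)) : ℝ) : ℂ) * I)) • (J y)ᴴ
      = ∑ y, cexp (((-(∑ i, q i * (w (σ y) i : ℝ)) : ℝ) : ℂ) * I) • J (σ y) :=
        Finset.sum_congr rfl fun y _ => by rw [hphase, ← hJ]
    _ = ∑ y, cexp (((-(∑ i, q i * (w y i : ℝ)) : ℝ) : ℂ) * I) • J y :=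
        Equiv.sum_comp σ (fun y => cexp (((-(∑ i, q i * (w y i : ℝ)) : ℝ) : ℂ) * I) • J y)

/-- **(P1) Positivity from diagonal dominance**: if `w_{y₀} = 0` (the on-site term) and, for every unit `u`,
`Re⟪u, J_{y₀} u⟫ ≥ r₀ + Σ_{y ≠ y₀} a_y` for a majorant `‖⟪u, J_y u⟫‖ ≤ a_y`, then `Re⟪u, B̃(q) u⟫ ≥ r₀` for all `q`. [folklore] -/
theorem le_re_inner_symbol_of_dominant [DecidableEq ι] (y₀ : ι) (hw₀ : w y₀ = 0) {a : ι → ℝ}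
    (ha : ∀ u : EuclideanSpace ℂ (Fin n), ‖u‖ = 1 → ∀ y, ‖⟪u, Matrix.toEuclideanLin (J y) u⟫_ℂ‖ ≤ a y) {r₀ : ℝ}
    (hdom : ∀ u : EuclideanSpace ℂ (Fin n), ‖u‖ = 1 →
      r₀ + ∑ y ∈ univ.erase y₀, a y ≤ RCLike.re ⟪u, Matrix.toEuclideanLin (J y₀) u⟫_ℂ)
    (u : EuclideanSpace ℂ (Fin n)) (hu : ‖u‖ = 1) (q : Fin 3 → ℝ) :
    r₀ ≤ RCLike.re ⟪u, Matrix.toEuclideanLin (Bt q) u⟫_ℂ := by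
  rw [re_inner_symbol w J Bt hBt u q, ← Finset.add_sum_erase _ _ (Finset.mem_univ y₀), Complex.add_re, Complex.re_sum]
  have h0 : cexp (((-(∑ i, q i * (w y₀ i : ℝ)) : ℝ) : ℂ) * I) = 1 := by simp [hw₀]
  rw [h0, mul_one]
  have h1 : ∀ y ∈ univ.erase y₀,
      -a y ≤ (⟪u, Matrix.toEuclideanLin (J y) u⟫_ℂ * cexp (((-(∑ i, q i * (w y i : ℝ)) : ℝ) : ℂ) * I)).re := by
    intro y _
    have h := Complex.abs_re_le_norm (⟪u, Matrix.toEuclideanLin (J y) u⟫_ℂ * cexp (((-(∑ i, q i * (w y i : ℝ)) : ℝ) : ℂ) * I))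
    rw [norm_mul, Complex.norm_exp_ofReal_mul_I, mul_one] at h
    linarith [(abs_le.1 h).1, ha u hu y]
  have h2 : -∑ y ∈ univ.erase y₀, a y ≤
      ∑ y ∈ univ.erase y₀, (⟪u, Matrix.toEuclideanLin (J y) u⟫_ℂ * cexp (((-(∑ i, q i * (w y i : ℝ)) : ℝ) : ℂ) * I)).re := by
    rw [← Finset.sum_neg_distrib]
    exact Finset.sum_le_sum h1
  have h3 := hdom u hu
  have h4 : RCLike.re ⟪u, Matrix.toEuclideanLin (J y₀) u⟫_ℂ = (⟪u, Matrix.toEuclideanLin (J y₀) u⟫_ℂ).re := rfl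
  linarith

/-- **(P2) The log-C² bound for the Rayleigh quotients of the symbol** — the second field of `EffectiveBlochSymbolFamily`, with the
EXPLICIT constant `K = M₂/r₀ + M₀M₂/r₀²` (`M₀ = Σ_y a_y`, `M₂ = Σ_y a_y|w_y|²`): for every unit `u` and all `x, v ∈ ℝ³`,
`2 log R_u(x) − K|v|² ≤ log R_u(x+v) + log R_u(x−v)`, given a majorant `‖⟪u, J_y u⟫‖ ≤ a_y` and a uniform floor `R_u ≥ r₀ > 0`
(e.g. from `le_re_inner_symbol_of_dominant`). [folklore] -/
theorem symbol_logC2 {a : ι → ℝ}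
    (ha : ∀ u : EuclideanSpace ℂ (Fin n), ‖u‖ = 1 → ∀ y, ‖⟪u, Matrix.toEuclideanLin (J y) u⟫_ℂ‖ ≤ a y) {r₀ : ℝ}
    (hr₀ : 0 < r₀)
    (hpos : ∀ u : EuclideanSpace ℂ (Fin n), ‖u‖ = 1 → ∀ q, r₀ ≤ RCLike.re ⟪u, Matrix.toEuclideanLin (Bt q) u⟫_ℂ)
    (u : EuclideanSpace ℂ (Fin n)) (hu : ‖u‖ = 1) (x v : Fin 3 → ℝ) :
    2 * Real.log (RCLike.re ⟪u, Matrix.toEuclideanLin (Bt x) u⟫_ℂ) -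
        ((∑ y, a y * ∑ i, (w y i : ℝ) ^ 2) / r₀ + (∑ y, a y) * (∑ y, a y * ∑ i, (w y i : ℝ) ^ 2) / r₀ ^ 2) *
          ∑ i, v i ^ 2 ≤
      Real.log (RCLike.re ⟪u, Matrix.toEuclideanLin (Bt (x + v)) u⟫_ℂ) +
        Real.log (RCLike.re ⟪u, Matrix.toEuclideanLin (Bt (x - v)) u⟫_ℂ) :=
  trigSum_two_mul_log_le (fun y => ⟪u, Matrix.toEuclideanLin (J y) u⟫_ℂ) w (ha u hu)
    (fun q => RCLike.re ⟪u, Matrix.toEuclideanLin (Bt q) u⟫_ℂ) (fun q => re_inner_symbol w J Bt hBt u q) hr₀ (hpos u hu) x v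

end MatrixSymbol

/-- **Entrywise majorant of a quadratic form**: `‖⟪u, A u⟫‖ ≤ Σ_{j,k} ‖A_{jk}‖` for a unit vector `u` (use for the `a_y`). [folklore] -/
theorem norm_inner_toEuclideanLin_le {n : ℕ} (A : Matrix (Fin n) (Fin n) ℂ) (u : EuclideanSpace ℂ (Fin n)) (hu : ‖u‖ = 1) :
    ‖⟪u, Matrix.toEuclideanLin A u⟫_ℂ‖ ≤ ∑ j, ∑ k, ‖A j k‖ := by
  have hcoord : ∀ i, ‖u i‖ ≤ 1 := fun i => (PiLp.norm_apply_le u i).trans hu.le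
  rw [EuclideanSpace.inner_eq_star_dotProduct, Matrix.ofLp_toLpLin, Matrix.toLin'_apply, dotProduct]
  refine (norm_sum_le _ _).trans (Finset.sum_le_sum fun j _ => ?_)
  simp only [Matrix.mulVec, dotProduct, Finset.sum_mul, Pi.star_apply]
  refine (norm_sum_le _ _).trans (Finset.sum_le_sum fun k _ => ?_)
  rw [norm_mul, norm_mul, norm_star]
  have h1 : ‖A j k‖ * ‖(WithLp.ofLp u) k‖ ≤ ‖A j k‖ * 1 := mul_le_mul_of_nonneg_left (hcoord k) (norm_nonneg _)
  calc ‖A j k‖ * ‖(WithLp.ofLp u) k‖ * ‖(WithLp.ofLp u) j‖ ≤ ‖A j k‖ * 1 * 1 :=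
        mul_le_mul h1 (hcoord j) (norm_nonneg _) (by positivity)
    _ = ‖A j k‖ := by ring

end Summit.QuantumFields.YangMills.Theorems.GlueballBandRecursion.Symbol

end
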